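import Summits.Ventures.HSemireg.WedgeHankelRecurrenceCompleteIntersectionSynthesis

/-!
# Venture HSemireg — MACAULAY'S CORRESPONDENCE AT THE TOP RANK (the converse of N59): **every coprime pair `(g₁, g₂)` of polynomials of degree `≤ t + 1`, not both of degree `≤ t`, IS the pair
# of generators of a generic class: there is `q` on `[0, 2t]` with `R^{2t}(q) = t + 1` and `g₁, g₂ ∈ Rec^{2t}_{t+1}(q)`, and `q` is UNIQUE UP TO A SCALAR** — the class is the linear form on
# `K[X]_{≤ 2t}` vanishing on the hyperplane `g₁·K[X]_{≤ t−1} ⊕ g₂·K[X]_{≤ t−1}`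

HONEST FRAMING. Part of the Lean index of the computation cell `pub-hsemireg` (seat p10 gen 29, Sunday typer «UNIFORM-IN-n»).
LINEAR ALGEBRA OF HANKEL (catalecticant) MATRICES and of polynomials over a field ONLY: no variety, no cohomology theory, no sheaf, no Ext group and no semiregularity map is constructed
here; nothing here says that HC / HC_CM / HC_AV holds; no Literature fact is declared or used.  Custodian versions as in `WedgeHankelSiegelIdeal` (1/3); the dictionary («a general binary form
of degree `2t` ↔ a complete intersection of two forms of degree `t + 1` without common zero») is QUOTED, never asserted.

WHAT IS IN THE TREE / CHAINED.  N60 (`WedgeHankelRecurrenceCompleteIntersectionSynthesis`, № 389): `linearForm_exists_smul_of_ker_le`, `hkFun_zero_X_pow`, `mem_recSpace_level_iff`, `finrank_recSpace_level`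
(the case `2r ≤ N + 1` is there); N59 (№ 386) is the converse direction and is NOT imported; N18 (№ 173): `recSpace`, `mem_recSpace_iff`, `hkFun_X_pow_mul`, `exists_recSpace_self_eq_span`,
`mem_recSpace_iff_exists_mul`, `map_mulRight_degreeLT_le_recSpace`, `finrank_map_mulRight_degreeLT`, `finrank_polynomial_degreeLT`, `mem_degreeLT_succ_iff`, `finiteDimensional_recSpace`; N17 (№ 156)
`rank_hankel1_half_eq_zero_iff`.  Mathlib: `Matrix.rank_le_height`, `Submodule.exists_le_ker_of_lt_top`, `Submodule.comap_subtype_eq_top`, `Polynomial.degreeLT.basis` / `basis_val`, `Basis.ext`,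
`Submodule.finrank_sup_add_finrank_inf_eq`, `Submodule.eq_of_le_of_finrank_eq`, `IsCoprime.isUnit_of_dvd'`, `IsCoprime.dvd_of_dvd_mul_right`, `Polynomial.natDegree_eq_zero_of_isUnit`.
THIS FILE (namespace `Summit.Ventures.HSemireg.Wedge.HankelOuter` continued; CHAINED on N60; 0 definitions).  Level `N = t + t`; `H(g₁, g₂) := (degreeLT K t).map (mulRight g₁) ⊔ (degreeLT K t).map (mulRight g₂)`
(= `g₁·K[X]_{≤ t−1} + g₂·K[X]_{≤ t−1}`, spelled out).
* §602 **`map_mulRight_inf_map_mulRight_eq_bot_of_isCoprime_top`** (`gcd = 1`, degrees `≤ t + 1 ⇒` the two pieces are independent), **`finrank_hyperplane_top`** (`= 2t`), `map_mulRight_le_degreeLT_top`,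
  **`hyperplane_le_recSpace_level_top`** (`g₁, g₂ ∈ Rec_{t+1}(q′) ⇒ H ≤ Rec^{2t}_{2t}(q′)`).
* §603 EXISTENCE **`exists_class_top_of_isCoprime`** (`R^{2t}(q) = t + 1`, `g₁, g₂ ∈ Rec_{t+1}(q)`, `g₂ ∉ K·g₁`), UNIQUENESS **`exists_eq_smul_of_mem_recSpace_top`** (`q′ = c·q` on `[0, 2t]`).
Nothing Ext-side.  New names only.
-/

open Module Polynomial
open scoped Matrix Polynomial

namespace Summit.Ventures.HSemireg.Wedge.HankelOuter

open Summit.Ventures.HSemireg.Wedge Summit.Ventures.HSemireg.Wedge.Hankel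

variable (K : Type*) [Field K]

/-! ## §602. The hyperplane `g₁·K[X]_{≤ t−1} ⊕ g₂·K[X]_{≤ t−1}` of a coprime pair of degree `≤ t + 1` -/

/-- `deg g ≤ t + 1 ⇒ g·K[X]_{≤ t−1} ≤ K[X]_{≤ 2t}`. -/
theorem map_mulRight_le_degreeLT_top {g : K[X]} {t : ℕ} (hg : g.natDegree ≤ t + 1) : (Polynomial.degreeLT K t).map (LinearMap.mulRight K g) ≤ Polynomial.degreeLT K (t + t + 1) := by
  rintro _ ⟨p, hp, rfl⟩
  rw [LinearMap.mulRight_apply]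
  rcases eq_or_ne p 0 with rfl | hp0
  · rw [zero_mul]; exact Submodule.zero_mem _
  · have hpd := (Polynomial.natDegree_lt_iff_degree_lt hp0).mpr (Polynomial.mem_degreeLT.mp hp)
    rw [mem_degreeLT_succ_iff]
    exact (Polynomial.natDegree_mul_le).trans (by omega)

/-- **THE TWO PIECES ARE INDEPENDENT: `g₁·K[X]_{≤ t−1} ⊓ g₂·K[X]_{≤ t−1} = 0` for `gcd(g₁, g₂) = 1`, `g₁ ≠ 0` and `deg g₁ ≤ t + 1`, `deg g₂ ≤ t + 1` not both `≤ t`** (`p₁ g₁ = p₂ g₂ ⇒ g₂ ∣ p₁`, `g₁ ∣ p₂`; the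
full-degree generator cannot divide a polynomial of degree `< t`, so one cofactor vanishes, hence both). -/
theorem map_mulRight_inf_map_mulRight_eq_bot_of_isCoprime_top {g₁ g₂ : K[X]} {t : ℕ} (hcop : IsCoprime g₁ g₂) (hg₁0 : g₁ ≠ 0) (htop : g₁.natDegree = t + 1 ∨ g₂.natDegree = t + 1) :
    (Polynomial.degreeLT K t).map (LinearMap.mulRight K g₁) ⊓ (Polynomial.degreeLT K t).map (LinearMap.mulRight K g₂) = ⊥ := by
  rw [Submodule.eq_bot_iff]
  rintro x ⟨⟨p₁, hp₁, rfl⟩, ⟨p₂, hp₂, hx⟩⟩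
  simp only [LinearMap.mulRight_apply] at hx ⊢
  have h21 : g₂ ∣ p₁ := hcop.symm.dvd_of_dvd_mul_right ⟨p₂, by rw [← hx, mul_comm]⟩
  have h12 : g₁ ∣ p₂ := hcop.dvd_of_dvd_mul_right ⟨p₁, by rw [hx, mul_comm]⟩
  rcases htop with h1 | h2
  · have hp₂0 : p₂ = 0 := by
      by_contra hp0
      have hpd := (Polynomial.natDegree_lt_iff_degree_lt hp0).mpr (Polynomial.mem_degreeLT.mp hp₂)
      have := Polynomial.natDegree_le_of_dvd h12 hp0
      omega
    rw [hp₂0, zero_mul] at hx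
    rcases mul_eq_zero.mp hx.symm with h | h
    · rw [h, zero_mul]
    · exact absurd h hg₁0
  · have hp₁0 : p₁ = 0 := by
      by_contra hp0
      have hpd := (Polynomial.natDegree_lt_iff_degree_lt hp0).mpr (Polynomial.mem_degreeLT.mp hp₁)
      have := Polynomial.natDegree_le_of_dvd h21 hp0
      omega
    rw [hp₁0, zero_mul]

/-- **`dim (g₁·K[X]_{≤ t−1} ⊕ g₂·K[X]_{≤ t−1}) = 2t`: a hyperplane of `K[X]_{≤ 2t}`.** -/
theorem finrank_hyperplane_top {g₁ g₂ : K[X]} {t : ℕ} (hcop : IsCoprime g₁ g₂) (hg₁0 : g₁ ≠ 0) (hg₂0 : g₂ ≠ 0) (htop : g₁.natDegree = t + 1 ∨ g₂.natDegree = t + 1) :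
    finrank K ↥((Polynomial.degreeLT K t).map (LinearMap.mulRight K g₁) ⊔ (Polynomial.degreeLT K t).map (LinearMap.mulRight K g₂)) = t + t := by
  have hsum := Submodule.finrank_sup_add_finrank_inf_eq ((Polynomial.degreeLT K t).map (LinearMap.mulRight K g₁)) ((Polynomial.degreeLT K t).map (LinearMap.mulRight K g₂))
  rw [map_mulRight_inf_map_mulRight_eq_bot_of_isCoprime_top K hcop hg₁0 htop, finrank_bot, Nat.add_zero, finrank_map_mulRight_degreeLT K hg₁0, finrank_map_mulRight_degreeLT K hg₂0] at hsum
  omega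

/-- **`g₁, g₂ ∈ Rec_{t+1}(q′) ⇒ g₁·K[X]_{≤ t−1} ⊕ g₂·K[X]_{≤ t−1} ≤ Rec^{2t}_{2t}(q′)`** (shifts, N18). -/
theorem hyperplane_le_recSpace_level_top {g₁ g₂ : K[X]} {t : ℕ} {q' : ℕ → K} (hg₁ : g₁ ∈ recSpace K (t + t) q' (t + 1)) (hg₂ : g₂ ∈ recSpace K (t + t) q' (t + 1)) :
    (Polynomial.degreeLT K t).map (LinearMap.mulRight K g₁) ⊔ (Polynomial.degreeLT K t).map (LinearMap.mulRight K g₂) ≤ recSpace K (t + t) q' (t + t) := by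
  rcases Nat.eq_zero_or_pos t with rfl | ht
  · rw [show (Polynomial.degreeLT K 0).map (LinearMap.mulRight K g₁) = ⊥ from ?_, show (Polynomial.degreeLT K 0).map (LinearMap.mulRight K g₂) = ⊥ from ?_, bot_sup_eq]
    · exact bot_le
    all_goals
      rw [Submodule.eq_bot_iff]
      rintro _ ⟨p, hp, rfl⟩
      rw [SetLike.mem_coe, Polynomial.mem_degreeLT, Nat.cast_zero, Nat.WithBot.lt_zero_iff, Polynomial.degree_eq_bot] at hp
      rw [hp, map_zero]
  · refine sup_le ?_ ?_
    · have h := map_mulRight_degreeLT_le_recSpace K hg₁ (t - 1)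
      rwa [show t - 1 + 1 = t by omega, show t + 1 + (t - 1) = t + t by omega] at h
    · have h := map_mulRight_degreeLT_le_recSpace K hg₂ (t - 1)
      rwa [show t - 1 + 1 = t by omega, show t + 1 + (t - 1) = t + t by omega] at h

/-! ## §603. Existence and uniqueness of the generic class of a coprime pair -/

/-- `g₂ ≠ 0` under the standing hypotheses. -/
theorem ne_zero_of_isCoprime_top {g₁ g₂ : K[X]} {t : ℕ} (hcop : IsCoprime g₁ g₂) (htop : g₁.natDegree = t + 1 ∨ g₂.natDegree = t + 1) : g₂ ≠ 0 := by
  rintro rfl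
  have hu : IsUnit g₁ := isCoprime_zero_right.mp hcop
  have := Polynomial.natDegree_eq_zero_of_isUnit hu
  rw [Polynomial.natDegree_zero] at htop; omega

/-- **MACAULAY'S CORRESPONDENCE AT THE TOP RANK, EXISTENCE: for `g₁ ≠ 0`, `g₂` with `deg g₁, deg g₂ ≤ t + 1`, `gcd(g₁, g₂) = 1` and (`deg g₁ = t + 1` or `deg g₂ = t + 1`), there is a class `q`
on `[0, 2t]` with `R^{2t}(q) = t + 1`, `g₁, g₂ ∈ Rec^{2t}_{t+1}(q)` and `g₂ ∉ K·g₁`** (`q_j := f(X^j)` for a non-zero linear form killing the hyperplane; the rank is at most `t + 1` by the shape of the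
middle Hankel matrix and cannot be `≤ t`, for then the minimal recurrence would divide `g₁` and `g₂`, be a unit, and bound both degrees by `t`). -/
theorem exists_class_top_of_isCoprime {g₁ g₂ : K[X]} {t : ℕ} (hg₁0 : g₁ ≠ 0) (hd₁ : g₁.natDegree ≤ t + 1) (hd₂ : g₂.natDegree ≤ t + 1) (hcop : IsCoprime g₁ g₂)
    (htop : g₁.natDegree = t + 1 ∨ g₂.natDegree = t + 1) :
    ∃ q : ℕ → K, (hankel1 K (t + t) ((t + t) / 2) q).rank = t + 1 ∧ g₁ ∈ recSpace K (t + t) q (t + 1) ∧ g₂ ∈ recSpace K (t + t) q (t + 1) ∧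
      g₂ ∉ (Polynomial.degreeLT K (0 + 1)).map (LinearMap.mulRight K g₁) := by
  have hg₂0 : g₂ ≠ 0 := ne_zero_of_isCoprime_top K hcop htop
  set V : Submodule K K[X] := Polynomial.degreeLT K (t + t + 1) with hV
  set H : Submodule K K[X] := (Polynomial.degreeLT K t).map (LinearMap.mulRight K g₁) ⊔ (Polynomial.degreeLT K t).map (LinearMap.mulRight K g₂) with hH
  have hHV : H ≤ V := sup_le (map_mulRight_le_degreeLT_top K hd₁) (map_mulRight_le_degreeLT_top K hd₂)
  have hHdim : finrank K H = t + t := finrank_hyperplane_top K hcop hg₁0 hg₂0 htop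
  have hlt : H.comap V.subtype < ⊤ := by
    refine lt_top_iff_ne_top.mpr fun htop' => ?_
    rw [Submodule.comap_subtype_eq_top] at htop'
    have h1 := Submodule.finrank_mono htop'
    rw [hHdim, hV, finrank_polynomial_degreeLT] at h1
    omega
  obtain ⟨f, hf0, hfker⟩ := Submodule.exists_le_ker_of_lt_top _ hlt
  let q : ℕ → K := fun j => if h : j < t + t + 1 then f (Polynomial.degreeLT.basis K (t + t + 1) ⟨j, h⟩) else 0
  have hfq : f = (hkFun K q 0).comp V.subtype := by
    refine (Polynomial.degreeLT.basis K (t + t + 1)).ext fun i => ?_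
    rw [LinearMap.comp_apply, Submodule.subtype_apply, Polynomial.degreeLT.basis_val, hkFun_zero_X_pow]
    simp only [q, dif_pos i.2]
  have hHker : ∀ {P : K[X]}, P ∈ H → hkFun K q 0 P = 0 := fun {P} hP => by
    have h := LinearMap.mem_ker.mp (hfker (show (⟨P, hHV hP⟩ : V) ∈ H.comap V.subtype from hP))
    rw [hfq] at h
    exact h
  -- both generators are recurrences of window `t + 2`
  have hXs : ∀ s, s + (t + 1) ≤ t + t → (Polynomial.X : K[X]) ^ s ∈ Polynomial.degreeLT K t := fun s hs => by
    rw [show t = t - 1 + 1 by omega, mem_degreeLT_succ_iff]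
    exact (Polynomial.natDegree_pow_le).trans (by rw [Polynomial.natDegree_X, mul_one]; omega)
  have hmem : ∀ {g : K[X]}, g.natDegree ≤ t + 1 → (∀ s, s + (t + 1) ≤ t + t → Polynomial.X ^ s * g ∈ H) → g ∈ recSpace K (t + t) q (t + 1) := fun hg hsh => by
    rw [mem_recSpace_iff]
    refine ⟨(mem_degreeLT_succ_iff K).mpr hg, fun s hs => ?_⟩
    rw [← zero_add s, ← hkFun_X_pow_mul]
    exact hHker (hsh s hs)
  have hg₁q : g₁ ∈ recSpace K (t + t) q (t + 1) := hmem hd₁ fun s hs => Submodule.mem_sup_left ⟨Polynomial.X ^ s, hXs s hs, by rw [LinearMap.mulRight_apply]⟩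
  have hg₂q : g₂ ∈ recSpace K (t + t) q (t + 1) := hmem hd₂ fun s hs => Submodule.mem_sup_right ⟨Polynomial.X ^ s, hXs s hs, by rw [LinearMap.mulRight_apply]⟩
  -- the rank is `t + 1`
  have hR : (hankel1 K (t + t) ((t + t) / 2) q).rank = t + 1 := by
    set R := (hankel1 K (t + t) ((t + t) / 2) q).rank with hRdef
    have hRle : R ≤ t + 1 := by
      have h := Matrix.rank_le_height (hankel1 K (t + t) ((t + t) / 2) q)
      have ht : (t + t) / 2 = t := by omega
      rw [ht] at h hRdef
      omega
    have hR1 : 1 ≤ R := by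
      by_contra hR0
      have hq0 := (rank_hankel1_half_eq_zero_iff K (N := t + t) q).mp (by omega)
      refine hf0 ((Polynomial.degreeLT.basis K (t + t + 1)).ext fun i => ?_)
      rw [hfq, LinearMap.comp_apply, Submodule.subtype_apply, Polynomial.degreeLT.basis_val, hkFun_zero_X_pow, LinearMap.zero_apply]
      exact hq0 i (by have := i.2; omega)
    by_contra hne
    have hRlt : R ≤ t := by omega
    obtain ⟨m₀, hm₀0, hspan⟩ := exists_recSpace_self_eq_span K hRdef.symm (by omega)
    have hm₀ : m₀ ∈ recSpace K (t + t) q R := by rw [hspan]; exact Submodule.mem_span_singleton_self m₀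
    have hdm₁ : m₀ ∣ g₁ := dvd_of_mem_recSpace K hRdef.symm (by omega) hm₀ hm₀0 hg₁q
    have hdm₂ : m₀ ∣ g₂ := dvd_of_mem_recSpace K hRdef.symm (by omega) hm₀ hm₀0 hg₂q
    have hu : IsUnit m₀ := hcop.isUnit_of_dvd' hdm₁ hdm₂
    have hdeg0 : m₀.natDegree = 0 := Polynomial.natDegree_eq_zero_of_isUnit hu
    have hbound : ∀ {g : K[X]}, g ∈ recSpace K (t + t) q (t + 1) → g.natDegree ≤ t := fun {g} hg => by
      have hg' : g ∈ recSpace K (t + t) q (R + (t + 1 - R)) := by rw [show R + (t + 1 - R) = t + 1 by omega]; exact hg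
      obtain ⟨h, hh, hhg⟩ := (mem_recSpace_iff_exists_mul K hRdef.symm (by omega) hm₀ hm₀0).mp hg'
      rw [← hhg]
      rcases eq_or_ne h 0 with rfl | hh0
      · rw [zero_mul, Polynomial.natDegree_zero]; omega
      · rw [Polynomial.natDegree_mul hh0 hm₀0, hdeg0]
        have := (mem_degreeLT_succ_iff K).mp hh; omega
    rcases htop with h | h
    · have := hbound hg₁q; omega
    · have := hbound hg₂q; omega
  refine ⟨q, hR, hg₁q, hg₂q, ?_⟩
  -- `g₂ ∉ K·g₁`
  rintro ⟨ρ, hρ, hρg⟩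
  rw [LinearMap.mulRight_apply] at hρg
  have hu : IsUnit g₁ := hcop.isUnit_of_dvd' (dvd_refl _) ⟨ρ, by rw [← hρg, mul_comm]⟩
  have h0 : g₁.natDegree = 0 := Polynomial.natDegree_eq_zero_of_isUnit hu
  have hρd := (mem_degreeLT_succ_iff K).mp hρ
  have h2' : g₂.natDegree ≤ 0 := by rw [← hρg]; exact (Polynomial.natDegree_mul_le).trans (by omega)
  rcases htop with h | h <;> omega

/-- **MACAULAY'S CORRESPONDENCE AT THE TOP RANK, UNIQUENESS: if `R^{2t}(q) = t + 1`, `g₁ ≠ 0`, `gcd(g₁, g₂) = 1`, `deg g₁ = t + 1` or `deg g₂ = t + 1`, and `g₁, g₂ ∈ Rec_{t+1}(q)`, then every `q′`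
with `g₁, g₂ ∈ Rec_{t+1}(q′)` is `c·q` on `[0, 2t]`** (both top windows contain the hyperplane; `Rec^{2t}_{2t}(q)` IS it by dimension; nested kernels ⇒ proportional linear forms). -/
theorem exists_eq_smul_of_mem_recSpace_top {g₁ g₂ : K[X]} {t : ℕ} {q q' : ℕ → K} (hq : (hankel1 K (t + t) ((t + t) / 2) q).rank = t + 1) (hg₁0 : g₁ ≠ 0) (hcop : IsCoprime g₁ g₂)
    (htop : g₁.natDegree = t + 1 ∨ g₂.natDegree = t + 1) (hg₁ : g₁ ∈ recSpace K (t + t) q (t + 1)) (hg₂ : g₂ ∈ recSpace K (t + t) q (t + 1))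
    (hg₁' : g₁ ∈ recSpace K (t + t) q' (t + 1)) (hg₂' : g₂ ∈ recSpace K (t + t) q' (t + 1)) : ∃ c : K, ∀ j ≤ t + t, q' j = c * q j := by
  have hg₂0 : g₂ ≠ 0 := ne_zero_of_isCoprime_top K hcop htop
  set V : Submodule K K[X] := Polynomial.degreeLT K (t + t + 1) with hV
  set H : Submodule K K[X] := (Polynomial.degreeLT K t).map (LinearMap.mulRight K g₁) ⊔ (Polynomial.degreeLT K t).map (LinearMap.mulRight K g₂) with hH
  haveI := finiteDimensional_recSpace K (N := t + t) q (t + t)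
  have hHeq : H = recSpace K (t + t) q (t + t) :=
    Submodule.eq_of_le_of_finrank_eq (hyperplane_le_recSpace_level_top K hg₁ hg₂) (by rw [finrank_hyperplane_top K hcop hg₁0 hg₂0 htop, finrank_recSpace_level K hq (by omega)])
  have hH' : H ≤ recSpace K (t + t) q' (t + t) := hyperplane_le_recSpace_level_top K hg₁' hg₂'
  have hker : LinearMap.ker ((hkFun K q 0).comp V.subtype) ≤ LinearMap.ker ((hkFun K q' 0).comp V.subtype) := by
    intro P hP
    rw [LinearMap.mem_ker, LinearMap.comp_apply, Submodule.subtype_apply] at hP ⊢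
    have hPq : (P : K[X]) ∈ recSpace K (t + t) q (t + t) := (mem_recSpace_level_iff K).mpr ⟨P.2, hP⟩
    rw [← hHeq] at hPq
    exact ((mem_recSpace_level_iff K).mp (hH' hPq)).2
  obtain ⟨c, hc⟩ := linearForm_exists_smul_of_ker_le hker
  refine ⟨c, fun j hj => ?_⟩
  have hXj : (Polynomial.X : K[X]) ^ j ∈ V := (mem_degreeLT_succ_iff K).mpr ((Polynomial.natDegree_pow_le).trans (by rw [Polynomial.natDegree_X, mul_one]; exact hj))
  have h := hc ⟨Polynomial.X ^ j, hXj⟩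
  simp only [LinearMap.comp_apply, Submodule.subtype_apply, hkFun_zero_X_pow] at h
  exact h

end Summit.Ventures.HSemireg.Wedge.HankelOuter
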